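import Summits.BirchSwinnertonDyer.BirchSwinnertonDyer.Theorems.GenusKolyvaginAtTwoTorsionCellD0TripleTwistBound
import Literature.NumberTheory.EllipticCurves.TwistFamilySelmerCorankParityProofs
import Literature.NumberTheory.EllipticCurves.BSDSelmer
import HarnessLib

/-!
# D0≤2, one genus step: `#Sel⁽²⁾(E₀^{(−p₀q₁q₂)}/ℚ) = 8` from `2`-parity (the `(q₁q₂/p₀) = −1` case, CONDITIONAL)

Crux R″ `RankOneTwoTorsionResidualAtTwo` (stmt-27478), LINE 49 «full_vertex», stub D0≤2
`FullTorsionGenusSelmerLawUpToTwoAtTwo`, slice `#Q₀ = 2`, `C₁ = E₀^{(−p₀q₁q₂)}`. The parity-free descent gives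
`#Sel⁽²⁾(C₁) ∈ {4, 8}` (`…D0TripleTwistBound`) and `= 8` when `(q₁q₂/p₀) = +1` (`…D0TripleTwistEight`). In the
complementary case the last bit is a PARITY bit: this file records the conditional closing step
**`natCard_selmerGroup_twist_triple_eq_eight_of_rootNumber`** — granted the Cassels–Tate theorem over `ℚ`
(`exists_casselsTate_pairing`, a hypothesis here; assembled elsewhere in the tree from the level-theta datum), the
`2`-parity theorem `p_parity C₁ 2` (Dokchitser–Dokchitser 2010, a NAMED FACT of the tree, unproved) and the sign
`w(C₁) = −1`: `#Sel⁽²⁾(C₁) = 4 = #C₁(ℚ)[2]` would force `corank Sel_{2^∞}(C₁) = 0`, contradicting `w = −1`.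
CONDITIONAL (named-fact hypotheses displayed); the sign `w(E₀^{(−p₀q₁q₂)}) = −w(E₀) = −1` under the split conditions
is NOT derived here (tree: `rootNumber_quadraticTwist_of_emod_four_eq_one`, itself modulo modularity `exists_isNewformOf`).

Everything else is proved; no LINE 49 statement is restated; BSD is not advanced by this file alone.

## References

* [DokchitserDokchitserAnnals2010] T. Dokchitser, V. Dokchitser, *On the Birch–Swinnerton-Dyer quotients modulo
  squares*, Ann. of Math. 172 (2010), Thm. 1.4.
* [SilvermanAEC2009] J. H. Silverman, *The Arithmetic of Elliptic Curves*, 2nd ed., GTM 106, Prop. X.1.4, X.4.9.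
-/

noncomputable section

open scoped Classical

namespace Summit.BirchSwinnertonDyer.BirchSwinnertonDyer.Theorems.GenusKolyvaginAtTwo.TorsionCellD0

open WeierstrassCurve WeierstrassCurve.Affine WeierstrassCurve.Affine.Point
open Literature.NumberTheory.GaloisRepresentations Literature.NumberTheory.EllipticCurves Field
open Literature.NumberTheory.EllipticCurves.TwoDescentLocal
open Literature.NumberTheory.EllipticCurves.KramerTwoDescent
open IsDedekindDomain NumberField Rat.HeightOneSpectrum

variable (E : WeierstrassCurve ℚ) [E.IsElliptic] {e₁ e₂ e₃ : ℚ}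
variable (S : Finset ℕ) {p q₁ q₂ : ℕ} [hp : Fact p.Prime] [hq₁ : Fact q₁.Prime] [hq₂ : Fact q₂.Prime]

/-- **`#Sel⁽²⁾ = 4` with full rational `2`-torsion forces `2^∞`-Selmer corank `0`** (granted Cassels–Tate), hence
root number `+1` under `2`-parity. [cite: DokchitserDokchitserAnnals2010, Thm. 1.4] -/
theorem rootNumber_eq_one_of_natCard_selmerGroup_eq_four (W : WeierstrassCurve ℚ) [W.IsElliptic] {f₁ f₂ f₃ : ℚ}
    (hW : W.toAffine.SplitTwoTorsion f₁ f₂ f₃) (hCT : WeierstrassCurve.exists_casselsTate_pairing (K := ℚ))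
    (hPar : p_parity W 2) (h4 : Nat.card (W.selmerGroup 2) = 4) : W.rootNumber = 1 := by
  haveI : Fact (Nat.Prime 2) := ⟨Nat.prime_two⟩
  have ht4 := W.natCard_torsionBy_two_eq_four (inst := fun a b => Classical.propDecidable (a = b)) hW
  obtain ⟨hle, -⟩ := selmerCorank_le_and_even_of_card hCT W 2 2 2
    (by rw [Nat.cast_ofNat, h4]; norm_num) (by rw [Nat.cast_ofNat, ht4]; norm_num)
  have h0 : W.selmerCorank 2 = 0 := by omega
  have := hPar
  rw [p_parity, h0, pow_zero] at this
  exact this.symm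

/-- **`#Sel⁽²⁾(E₀^{(−p₀q₁q₂)}/ℚ) = 8` from `2`-parity and the sign** (CONDITIONAL; setting of `…D0TripleTwistBound`):
granted Cassels–Tate over `ℚ`, `p_parity (E^{(d)}) 2` (Dokchitser–Dokchitser) and `w(E^{(d)}) = −1`, the parity-free
dichotomy `#Sel⁽²⁾ ∈ {4, 8}` resolves to `8`. [cite: DokchitserDokchitserAnnals2010, Thm. 1.4]
[cite: SilvermanAEC2009, Prop. X.1.4, Prop. X.4.9] -/
theorem natCard_selmerGroup_twist_triple_eq_eight_of_rootNumber (h : E.toAffine.SplitTwoTorsion e₁ e₂ e₃)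
    (hS : ∀ q ∈ S, q.Prime) (h2S : 2 ∈ S) (h12 : e₁ < e₂) (h23 : e₂ < e₃)
    (hgood : ∀ ℓ : ℕ, (hℓ : ℓ.Prime) → ℓ ∉ S → haveI : Fact ℓ.Prime := ⟨hℓ⟩;
      padicValRat ℓ (e₁ - e₂) = 0 ∧ padicValRat ℓ (e₁ - e₃) = 0 ∧ padicValRat ℓ (e₂ - e₃) = 0)
    (hN : ∀ ℓ : ℕ, ℓ.Prime → ℓ ∉ S → ¬ ℓ ∣ E.conductorNorm ℤ)
    (hrank : E.mordellWeilRank = 0) (hsha : ∀ x ∈ E.sha, (2 : ℕ) • x = 0 → x = 0)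
    (hpS : p ∉ S) (hq₁S : q₁ ∉ S) (hq₂S : q₂ ∉ S) (hpq₁ : p ≠ q₁) (hpq₂ : p ≠ q₂) (hne : q₁ ≠ q₂)
    (hp8 : p % 8 = 7) (hq₁4 : q₁ % 4 = 3) (hq₂4 : q₂ % 4 = 3) (hM8 : ((q₁ : ℤ) * q₂) % 8 = 1)
    (hsplitp : ∀ ℓ ∈ S, (hℓ : ℓ.Prime) → ℓ ≠ 2 → haveI : Fact ℓ.Prime := ⟨hℓ⟩; legendreSym ℓ (-(p : ℤ)) = 1)
    (hsplitM : ∀ ℓ ∈ S, (hℓ : ℓ.Prime) → ℓ ≠ 2 → haveI : Fact ℓ.Prime := ⟨hℓ⟩; legendreSym ℓ ((q₁ : ℤ) * q₂) = 1)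
    (hδ₁₁ : qrBit q₁ ((e₁ - e₂) * (e₁ - e₃)) = 1) (hδ₂₁ : qrBit q₁ ((e₂ - e₁) * (e₂ - e₃)) = 1)
    (hδ₁₂ : qrBit q₂ ((e₁ - e₂) * (e₁ - e₃)) = 1) (hδ₂₂ : qrBit q₂ ((e₂ - e₁) * (e₂ - e₃)) = 1)
    (ht : qrBit q₂ (e₂ - e₁) = qrBit q₁ (e₂ - e₁))
    {d : ℚ} (hd : d = -(p : ℚ) * ((q₁ : ℚ) * q₂)) [(E.quadraticTwist d).IsElliptic]
    (hCT : WeierstrassCurve.exists_casselsTate_pairing (K := ℚ)) (hPar : p_parity (E.quadraticTwist d) 2)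
    (hw : (E.quadraticTwist d).rootNumber = -1) :
    Nat.card (selmerGroup (E.quadraticTwist d) 2) = 8 := by
  rcases natCard_selmerGroup_twist_triple_eq_four_or_eight E S h hS h2S h12 h23 hgood hN hrank hsha hpS hq₁S hq₂S hpq₁ hpq₂
    hne hp8 hq₁4 hq₂4 hM8 hsplitp hsplitM hδ₁₁ hδ₂₁ hδ₁₂ hδ₂₂ ht hd with h4 | h8
  · exfalso
    have h1 := rootNumber_eq_one_of_natCard_selmerGroup_eq_four (E.quadraticTwist d) (h.quadraticTwist d) hCT hPar h4
    rw [h1] at hw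
    norm_num at hw
  · exact h8

end Summit.BirchSwinnertonDyer.BirchSwinnertonDyer.Theorems.GenusKolyvaginAtTwo.TorsionCellD0

end
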